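import Summits.AtomisticToContinuum.FouriersLaw.Theorems.BoundaryEscapeDeficitHalfChainLocalityTransferAsymptotics
import Summits.AtomisticToContinuum.FouriersLaw.Theorems.BondHeatUncertaintyLightConeBondHeatGibbsByParts
import Literature.MathematicalPhysics.KineticTheory.LangevinChainKernel
import Literature.MathematicalPhysics.KineticTheory.ChainReflection
import Summits.AtomisticToContinuum.FouriersLaw.Theorems.JunctionLocalityNonBallisticProfileUniformBound

/-!
# Transfer of integrals from the long chain to the boundary window (pinned chain)

Helper file (`--supports stmt-AtomisticToContinuum-12240`, item `HalfChainLocality` of route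
`BoundaryEscapeDeficit`, sub-problem `FouriersLaw`). Specialises the transfer-operator files
(`…WindowMarginal`, `…TransferAsymptotics`) to `P = pinnedChain ω₂ lam β γ` (`ω₂ > 0`, `lam, β ≥ 0`,
`T > 0`): `μ_N = gibbsMeasure N T`, window map `take_{ℓ+1} : PhaseSpace (n+1) → PhaseSpace (ℓ+1)`,
`W = wienerPair`.

* `pinnedChain_siteMeasure_isFinite` — the one-site measure `ρ` is finite (`ρ(ℝ²) = Z_1 < ∞`);
* `pinnedChain_exists_windowDensity` (**package**) — a constant `D* > 0` such that for all `ℓ ≤ n`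
  the law of the window under `μ_{n+1}` is `μ_{ℓ+1}.withDensity D` with a measurable `D ≤ D*`, and for
  fixed `ℓ` these densities converge uniformly as `n → ∞`;
* `lintegral_comp_take_prod_le` — TRANSFER: for measurable `G ≥ 0` on `PhaseSpace (ℓ+1) × W`,
  `∫ G(take x, ω) d(μ_{n+1} ⊗ W) ≤ D* ∫ G d(μ_{ℓ+1} ⊗ W)`, and the position-only version;
* `integral_comp_take_prod_eq` — for integrable real `F` on `PhaseSpace (ℓ+1) × W`:
  `∫ F(take x, ω) d(μ_{n+1} ⊗ W) = ∫ D(y) (∫ F(y, ·) dW) dμ_{ℓ+1}(y)`;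
* `pinnedChain_measure_abs_position_gt_le` — `N`-UNIFORM POSITION TAILS: there is `C_q` with
  `μ_{n+1} {r < |q_k|} ≤ C_q / r⁸` for all `k ≤ n`, `r > 0` (window transfer + left–right symmetry of the Gibbs
  measure, `NonBallistic.measurePreserving_siteReflection_gibbsMeasure`, + window of size one + Markov for `q_0⁸`
  under `μ_1`; needs `lam > 0`).

Folklore; no definitions.
-/

noncomputable section

open MeasureTheory ProbabilityTheory Set Filter Topology Function
open scoped NNReal ENNReal

namespace Summit.AtomisticToContinuum.FouriersLaw.Theorems.HalfChainLocality

open Literature.MathematicalPhysics.KineticTheory Literature.MathematicalPhysics.KineticTheory.HeatConduction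
open Literature.Probability.Process OscillatorChain

variable {ω₂ lam β γ T : ℝ}

/-! ### The hypotheses of the transfer-operator files for the pinned chain -/

/-- `U`, `V` of the pinned chain are continuous, `V ≥ 0` and `V` is even. [folklore] -/
theorem pinnedChain_UV_props (ω₂ lam : ℝ) {β : ℝ} (hβ : 0 ≤ β) (γ : ℝ) :
    Continuous (pinnedChain ω₂ lam β γ).U ∧ Continuous (pinnedChain ω₂ lam β γ).V ∧
      (∀ r, 0 ≤ (pinnedChain ω₂ lam β γ).V r) ∧ (∀ r, (pinnedChain ω₂ lam β γ).V (-r) = (pinnedChain ω₂ lam β γ).V r) := by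
  refine ⟨(pinnedChain_contDiff_U ω₂ lam β γ (n := 0)).continuous, (pinnedChain_contDiff_V ω₂ lam β γ (n := 0)).continuous,
    fun r => ?_, pinnedChain_V_neg ω₂ lam β γ⟩
  show 0 ≤ r ^ 2 / 2 + β * r ^ 4 / 4
  positivity

/-- The one-site a priori measure `ρ = e^{-(p²/2+U(q))/T} dq dp` of the pinned chain has total mass
`Z_1 < ∞`; in particular it is finite. [folklore] -/
theorem pinnedChain_siteMeasure_isFinite (hω : 0 < ω₂) (hl : 0 ≤ lam) (hβ : 0 ≤ β) (γ : ℝ) (hT : 0 < T) :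
    (volume.withDensity fun z : ℝ × ℝ =>
        ENNReal.ofReal (Real.exp (-(z.2 ^ 2 / 2 + (pinnedChain ω₂ lam β γ).U z.1) / T))) univ =
      (pinnedChain ω₂ lam β γ).partitionFunction 1 T ∧
    IsFiniteMeasure (volume.withDensity fun z : ℝ × ℝ =>
        ENNReal.ofReal (Real.exp (-(z.2 ^ 2 / 2 + (pinnedChain ω₂ lam β γ).U z.1) / T))) := by
  obtain ⟨hUc, hVc, -, -⟩ := pinnedChain_UV_props ω₂ lam hβ γ
  have h := partitionFunction_succ_eq_lintegral_transferIterate (pinnedChain ω₂ lam β γ) hUc.measurable hVc.measurable T 0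
  simp only [Function.iterate_zero, id_eq, Pi.one_apply, lintegral_one, Nat.zero_add] at h
  refine ⟨h.symm, ⟨?_⟩⟩
  rw [← h]
  exact (partitionFunction_ne_top _ (pinnedChain_integrable_gibbsDensity hω hl hβ γ 1 hT)).lt_top

/-- **The window-density package for the pinned chain.** There is `D* > 0` such that:
(a) for all `ℓ ≤ n` there is a measurable `D : PhaseSpace (ℓ+1) → ℝ≥0∞` with `D ≤ D*` and
`μ_{n+1} ∘ take_{ℓ+1}⁻¹ = μ_{ℓ+1}.withDensity D`;
(b) for every `ℓ` there is `d_∞ : PhaseSpace (ℓ+1) → ℝ` such that for every `ε > 0`, for all large `n`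
the density in (a) can moreover be chosen with `|D.toReal - d_∞| ≤ ε` everywhere. [folklore] -/
theorem pinnedChain_exists_windowDensity (hω : 0 < ω₂) (hl : 0 ≤ lam) (hβ : 0 ≤ β) (γ : ℝ) (hT : 0 < T) :
    ∃ Dstar : ℝ, 0 < Dstar ∧
      (∀ (n ℓ : ℕ) (hℓ : ℓ ≤ n), ∃ D : PhaseSpace (ℓ + 1) → ℝ≥0∞, Measurable D ∧
        (∀ y, D y ≤ ENNReal.ofReal Dstar) ∧
        ((pinnedChain ω₂ lam β γ).gibbsMeasure (n + 1) T).map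
            (fun x : PhaseSpace (n + 1) =>
              ((Fin.take (ℓ + 1) (Nat.succ_le_succ hℓ) x.1 : Fin (ℓ + 1) → ℝ),
                (Fin.take (ℓ + 1) (Nat.succ_le_succ hℓ) x.2 : Fin (ℓ + 1) → ℝ))) =
          ((pinnedChain ω₂ lam β γ).gibbsMeasure (ℓ + 1) T).withDensity D) ∧
      (∀ ℓ : ℕ, ∃ dinf : PhaseSpace (ℓ + 1) → ℝ, ∀ ε : ℝ, 0 < ε → ∃ N₀ : ℕ, ∀ (n : ℕ) (hn : N₀ ≤ n),
        ∃ hℓ : ℓ ≤ n, ∃ D : PhaseSpace (ℓ + 1) → ℝ≥0∞, Measurable D ∧ (∀ y, D y ≤ ENNReal.ofReal Dstar) ∧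
        ((pinnedChain ω₂ lam β γ).gibbsMeasure (n + 1) T).map
            (fun x : PhaseSpace (n + 1) =>
              ((Fin.take (ℓ + 1) (Nat.succ_le_succ hℓ) x.1 : Fin (ℓ + 1) → ℝ),
                (Fin.take (ℓ + 1) (Nat.succ_le_succ hℓ) x.2 : Fin (ℓ + 1) → ℝ))) =
          ((pinnedChain ω₂ lam β γ).gibbsMeasure (ℓ + 1) T).withDensity D ∧
        ∀ y, |(D y).toReal - dinf y| ≤ ε) := by
  set P := pinnedChain ω₂ lam β γ with hP
  obtain ⟨hUc, hVc, hV0, hVsymm⟩ := pinnedChain_UV_props ω₂ lam hβ γ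
  obtain ⟨-, hfin⟩ := pinnedChain_siteMeasure_isFinite hω hl hβ γ hT
  obtain ⟨Dstar, hD0, hbound, hlim⟩ :=
    exists_windowDensity_bound_and_limit P T hUc hVc hV0 hVsymm hT hfin
  -- the density as a function of the window configuration
  have hmeas : ∀ n ℓ : ℕ, Measurable fun y : PhaseSpace (ℓ + 1) =>
      P.partitionFunction (ℓ + 1) T * (P.partitionFunction (n + 1) T)⁻¹ *
        ((fun g : ℝ × ℝ → ℝ≥0∞ => fun z : ℝ × ℝ =>
          ∫⁻ z', ENNReal.ofReal (Real.exp (-P.V (z'.1 - z.1) / T)) * g z'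
            ∂(volume.withDensity fun z' : ℝ × ℝ =>
              ENNReal.ofReal (Real.exp (-(z'.2 ^ 2 / 2 + P.U z'.1) / T))))^[n - ℓ] 1)
          (y.1 (Fin.last ℓ), y.2 (Fin.last ℓ)) := fun n ℓ =>
    ((measurable_transferStep_iterate P hVc.measurable T measurable_one (n - ℓ)).comp (measurable_lastSite ℓ)).const_mul _
  have hmap : ∀ (n ℓ : ℕ) (hℓ : ℓ ≤ n), (P.gibbsMeasure (n + 1) T).map
      (fun x : PhaseSpace (n + 1) =>
        ((Fin.take (ℓ + 1) (Nat.succ_le_succ hℓ) x.1 : Fin (ℓ + 1) → ℝ),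
          (Fin.take (ℓ + 1) (Nat.succ_le_succ hℓ) x.2 : Fin (ℓ + 1) → ℝ))) =
      (P.gibbsMeasure (ℓ + 1) T).withDensity fun y : PhaseSpace (ℓ + 1) =>
        P.partitionFunction (ℓ + 1) T * (P.partitionFunction (n + 1) T)⁻¹ *
          ((fun g : ℝ × ℝ → ℝ≥0∞ => fun z : ℝ × ℝ =>
            ∫⁻ z', ENNReal.ofReal (Real.exp (-P.V (z'.1 - z.1) / T)) * g z'
              ∂(volume.withDensity fun z' : ℝ × ℝ =>
                ENNReal.ofReal (Real.exp (-(z'.2 ^ 2 / 2 + P.U z'.1) / T))))^[n - ℓ] 1)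
            (y.1 (Fin.last ℓ), y.2 (Fin.last ℓ)) := fun n ℓ hℓ =>
    gibbsMeasure_map_take P hUc.measurable hVc.measurable T n ℓ hℓ
      (pinnedChain_integrable_gibbsDensity hω hl hβ γ (n + 1) hT)
      (pinnedChain_integrable_gibbsDensity hω hl hβ γ (ℓ + 1) hT) (pinnedChain_continuous_gibbsDensity ω₂ lam β γ _ T)
  refine ⟨Dstar, hD0, fun n ℓ hℓ => ⟨_, hmeas n ℓ, fun y => hbound n ℓ hℓ _, hmap n ℓ hℓ⟩, fun ℓ => ?_⟩
  obtain ⟨dinf, hdinf⟩ := hlim ℓ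
  refine ⟨fun y => dinf (y.1 (Fin.last ℓ), y.2 (Fin.last ℓ)), fun ε hε => ?_⟩
  obtain ⟨N₀, hℓN₀, hN₀⟩ := hdinf ε hε
  refine ⟨N₀, fun n hn => ⟨hℓN₀.trans hn, _, hmeas n ℓ, fun y => hbound n ℓ (hℓN₀.trans hn) _, hmap n ℓ (hℓN₀.trans hn),
    fun y => hN₀ n hn _⟩⟩

/-! ### Transfer of integrals to the window chain -/

section TransferLemmas

variable {n ℓ : ℕ} (hℓ : ℓ ≤ n) {Dstar : ℝ} {D : PhaseSpace (ℓ + 1) → ℝ≥0∞} (hDm : Measurable D)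
  (hDb : ∀ y, D y ≤ ENNReal.ofReal Dstar)
  (hmap : ((pinnedChain ω₂ lam β γ).gibbsMeasure (n + 1) T).map
      (fun x : PhaseSpace (n + 1) =>
        ((Fin.take (ℓ + 1) (Nat.succ_le_succ hℓ) x.1 : Fin (ℓ + 1) → ℝ),
          (Fin.take (ℓ + 1) (Nat.succ_le_succ hℓ) x.2 : Fin (ℓ + 1) → ℝ))) =
    ((pinnedChain ω₂ lam β γ).gibbsMeasure (ℓ + 1) T).withDensity D)
include hDm hDb hmap

/-- **Transfer, position form**: `∫ g(take x) dμ_{n+1} ≤ D* ∫ g dμ_{ℓ+1}` for measurable `g ≥ 0`.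
[folklore] -/
theorem lintegral_comp_take_le {g : PhaseSpace (ℓ + 1) → ℝ≥0∞} (hg : Measurable g) :
    ∫⁻ x, g ((Fin.take (ℓ + 1) (Nat.succ_le_succ hℓ) x.1 : Fin (ℓ + 1) → ℝ),
        (Fin.take (ℓ + 1) (Nat.succ_le_succ hℓ) x.2 : Fin (ℓ + 1) → ℝ)) ∂((pinnedChain ω₂ lam β γ).gibbsMeasure (n + 1) T) ≤
      ENNReal.ofReal Dstar * ∫⁻ y, g y ∂((pinnedChain ω₂ lam β γ).gibbsMeasure (ℓ + 1) T) := by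
  have hτ := measurable_take (ℓ + 1) (n + 1) (Nat.succ_le_succ hℓ)
  rw [← lintegral_map hg hτ, hmap, lintegral_withDensity_eq_lintegral_mul _ hDm hg, ← lintegral_const_mul _ hg]
  exact lintegral_mono fun y => mul_le_mul' (hDb y) le_rfl

/-- **Transfer, product form**: `∫ G(take x, ω) d(μ_{n+1} ⊗ W) ≤ D* ∫ G d(μ_{ℓ+1} ⊗ W)` for measurable
`G ≥ 0` on `PhaseSpace (ℓ+1) × WienerPair`. [folklore] -/
theorem lintegral_comp_take_prod_le {G : PhaseSpace (ℓ + 1) × WienerPair → ℝ≥0∞} (hG : Measurable G) :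
    ∫⁻ q, G (((Fin.take (ℓ + 1) (Nat.succ_le_succ hℓ) q.1.1 : Fin (ℓ + 1) → ℝ),
        (Fin.take (ℓ + 1) (Nat.succ_le_succ hℓ) q.1.2 : Fin (ℓ + 1) → ℝ)), q.2)
        ∂(((pinnedChain ω₂ lam β γ).gibbsMeasure (n + 1) T).prod wienerPair) ≤
      ENNReal.ofReal Dstar * ∫⁻ q, G q ∂(((pinnedChain ω₂ lam β γ).gibbsMeasure (ℓ + 1) T).prod wienerPair) := by
  have hτ := measurable_take (ℓ + 1) (n + 1) (Nat.succ_le_succ hℓ)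
  have hGτ : Measurable fun q : PhaseSpace (n + 1) × WienerPair =>
      G (((Fin.take (ℓ + 1) (Nat.succ_le_succ hℓ) q.1.1 : Fin (ℓ + 1) → ℝ),
        (Fin.take (ℓ + 1) (Nat.succ_le_succ hℓ) q.1.2 : Fin (ℓ + 1) → ℝ)), q.2) :=
    hG.comp ((hτ.comp measurable_fst).prodMk measurable_snd)
  rw [lintegral_prod _ hGτ.aemeasurable, lintegral_prod _ hG.aemeasurable]
  exact lintegral_comp_take_le hℓ hDm hDb hmap (g := fun y => ∫⁻ ω, G (y, ω) ∂wienerPair)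
    (Measurable.lintegral_prod_right' hG)

/-- **Transfer identity for integrable real integrands**: for `F` integrable on `μ_{ℓ+1} ⊗ W`,
`F(take x, ω)` is integrable on `μ_{n+1} ⊗ W` and
`∫ F(take x, ω) d(μ_{n+1} ⊗ W) = ∫ D(y).toReal (∫ F(y, ·) dW) dμ_{ℓ+1}(y)`. [folklore] -/
theorem integral_comp_take_prod_eq (hω : 0 < ω₂) (hl : 0 ≤ lam) (hβ : 0 ≤ β) (hT : 0 < T)
    {F : PhaseSpace (ℓ + 1) × WienerPair → ℝ} (hFm : Measurable F)
    (hF : Integrable F (((pinnedChain ω₂ lam β γ).gibbsMeasure (ℓ + 1) T).prod wienerPair)) :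
    Integrable (fun q : PhaseSpace (n + 1) × WienerPair =>
        F (((Fin.take (ℓ + 1) (Nat.succ_le_succ hℓ) q.1.1 : Fin (ℓ + 1) → ℝ),
          (Fin.take (ℓ + 1) (Nat.succ_le_succ hℓ) q.1.2 : Fin (ℓ + 1) → ℝ)), q.2))
        (((pinnedChain ω₂ lam β γ).gibbsMeasure (n + 1) T).prod wienerPair) ∧
    ∫ q, F (((Fin.take (ℓ + 1) (Nat.succ_le_succ hℓ) q.1.1 : Fin (ℓ + 1) → ℝ),
          (Fin.take (ℓ + 1) (Nat.succ_le_succ hℓ) q.1.2 : Fin (ℓ + 1) → ℝ)), q.2)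
        ∂(((pinnedChain ω₂ lam β γ).gibbsMeasure (n + 1) T).prod wienerPair) =
      ∫ y, (D y).toReal * (∫ ω, F (y, ω) ∂wienerPair) ∂((pinnedChain ω₂ lam β γ).gibbsMeasure (ℓ + 1) T) := by
  haveI := pinnedChain_isProbabilityMeasure_gibbsMeasure hω hl hβ γ (n + 1) hT
  haveI := pinnedChain_isProbabilityMeasure_gibbsMeasure hω hl hβ γ (ℓ + 1) hT
  have hτ := measurable_take (ℓ + 1) (n + 1) (Nat.succ_le_succ hℓ)
  have hFτm : Measurable fun q : PhaseSpace (n + 1) × WienerPair =>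
      F (((Fin.take (ℓ + 1) (Nat.succ_le_succ hℓ) q.1.1 : Fin (ℓ + 1) → ℝ),
        (Fin.take (ℓ + 1) (Nat.succ_le_succ hℓ) q.1.2 : Fin (ℓ + 1) → ℝ)), q.2) :=
    hFm.comp ((hτ.comp measurable_fst).prodMk measurable_snd)
  -- integrability by transfer of `∫ ‖F‖`
  have hint : Integrable (fun q : PhaseSpace (n + 1) × WienerPair =>
      F (((Fin.take (ℓ + 1) (Nat.succ_le_succ hℓ) q.1.1 : Fin (ℓ + 1) → ℝ),
        (Fin.take (ℓ + 1) (Nat.succ_le_succ hℓ) q.1.2 : Fin (ℓ + 1) → ℝ)), q.2))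
      (((pinnedChain ω₂ lam β γ).gibbsMeasure (n + 1) T).prod wienerPair) := by
    refine ⟨hFτm.aestronglyMeasurable, ?_⟩
    have h := lintegral_comp_take_prod_le hℓ hDm hDb hmap (G := fun q => ‖F q‖ₑ) hFm.enorm
    exact (h.trans_lt (ENNReal.mul_lt_top ENNReal.ofReal_lt_top hF.2)).ne.lt_top |> fun h' => h'
  refine ⟨hint, ?_⟩
  have hf : StronglyMeasurable fun y : PhaseSpace (ℓ + 1) => ∫ ω, F (y, ω) ∂wienerPair :=
    hFm.stronglyMeasurable.integral_prod_right'
  rw [integral_prod _ hint]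
  have e2 : ∫ x, (∫ ω, F (((Fin.take (ℓ + 1) (Nat.succ_le_succ hℓ) x.1 : Fin (ℓ + 1) → ℝ),
      (Fin.take (ℓ + 1) (Nat.succ_le_succ hℓ) x.2 : Fin (ℓ + 1) → ℝ)), ω) ∂wienerPair)
        ∂((pinnedChain ω₂ lam β γ).gibbsMeasure (n + 1) T) =
      ∫ y, (∫ ω, F (y, ω) ∂wienerPair) ∂(((pinnedChain ω₂ lam β γ).gibbsMeasure (n + 1) T).map
        (fun x : PhaseSpace (n + 1) => ((Fin.take (ℓ + 1) (Nat.succ_le_succ hℓ) x.1 : Fin (ℓ + 1) → ℝ),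
          (Fin.take (ℓ + 1) (Nat.succ_le_succ hℓ) x.2 : Fin (ℓ + 1) → ℝ)))) :=
    (integral_map (φ := fun x : PhaseSpace (n + 1) => ((Fin.take (ℓ + 1) (Nat.succ_le_succ hℓ) x.1 : Fin (ℓ + 1) → ℝ),
        (Fin.take (ℓ + 1) (Nat.succ_le_succ hℓ) x.2 : Fin (ℓ + 1) → ℝ)))
      (f := fun y : PhaseSpace (ℓ + 1) => ∫ ω, F (y, ω) ∂wienerPair) hτ.aemeasurable hf.aestronglyMeasurable).symm
  show ∫ x, (∫ ω, F (((Fin.take (ℓ + 1) (Nat.succ_le_succ hℓ) x.1 : Fin (ℓ + 1) → ℝ),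
      (Fin.take (ℓ + 1) (Nat.succ_le_succ hℓ) x.2 : Fin (ℓ + 1) → ℝ)), ω) ∂wienerPair)
        ∂((pinnedChain ω₂ lam β γ).gibbsMeasure (n + 1) T) = _
  rw [e2, hmap, integral_withDensity_eq_integral_toReal_smul hDm (Eventually.of_forall fun y =>
      (hDb y).trans_lt ENNReal.ofReal_lt_top)]
  rfl

end TransferLemmas

/-! ### `N`-uniform tails of the positions -/

open Summit.AtomisticToContinuum.FouriersLaw.Theorems.LightConeBondHeat in
/-- The eighth moment of the position under the one-site Gibbs measure is finite:
`q_0⁸` is `μ_1`-integrable (`q⁸ ≤ (1 + 4/lam)² (1+H)²`). [folklore] -/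
theorem pinnedChain_integrable_position_pow_eight_one (hω : 0 < ω₂) (hl : 0 < lam) (hβ : 0 ≤ β) (γ : ℝ) (hT : 0 < T) :
    Integrable (fun y : PhaseSpace 1 => y.1 0 ^ 8) ((pinnedChain ω₂ lam β γ).gibbsMeasure 1 T) := by
  refine (pinnedChain ω₂ lam β γ).integrable_gibbsMeasure ?_
  refine pinnedChain_integrable_mul_gibbsDensity_of_le_pow hω hl.le hβ γ 1 hT 2 (by fun_prop)
    (C := (1 + 4 / lam) ^ 2) fun x => ?_
  have h4 := pinnedChain_abs_position_pow_le hω.le hl hβ γ 1 x 0 (n := 4) le_rfl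
  have h0 : 0 ≤ 1 + (pinnedChain ω₂ lam β γ).hamiltonian 1 x := by
    have := abs_nonneg (x.1 0 ^ 4); have : 0 < 1 + 4 / lam := by positivity
    nlinarith
  rw [abs_of_nonneg (by positivity)] at h4 ⊢
  calc x.1 0 ^ 8 = (x.1 0 ^ 4) ^ 2 := by ring
    _ ≤ ((1 + 4 / lam) * (1 + (pinnedChain ω₂ lam β γ).hamiltonian 1 x)) ^ 2 :=
        pow_le_pow_left₀ (by positivity) h4 2
    _ = (1 + 4 / lam) ^ 2 * (1 + (pinnedChain ω₂ lam β γ).hamiltonian 1 x) ^ 2 := by ring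

open Summit.AtomisticToContinuum.FouriersLaw.Theorems.LightConeBondHeat in
/-- **`N`-uniform position tails.** There is `C_q ≥ 0` such that for all `k ≤ n` and `r > 0`,
`μ_{n+1} {x : r < |q_k(x)|} ≤ C_q / r⁸`. [folklore] -/
theorem pinnedChain_measure_abs_position_gt_le (hω : 0 < ω₂) (hl : 0 < lam) (hβ : 0 ≤ β) (γ : ℝ) (hT : 0 < T) :
    ∃ Cq : ℝ, 0 ≤ Cq ∧ ∀ (n k : ℕ) (hk : k ≤ n) (r : ℝ), 0 < r →
      ((pinnedChain ω₂ lam β γ).gibbsMeasure (n + 1) T) {x : PhaseSpace (n + 1) | r < |x.1 ⟨k, by omega⟩|} ≤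
        ENNReal.ofReal (Cq / r ^ 8) := by
  set P := pinnedChain ω₂ lam β γ with hP
  obtain ⟨Dstar, hD0, hwin, -⟩ := pinnedChain_exists_windowDensity hω hl.le hβ γ hT
  have hi8 := pinnedChain_integrable_position_pow_eight_one hω hl hβ γ hT
  set M8 : ℝ := ∫ y, y.1 0 ^ 8 ∂(P.gibbsMeasure 1 T) with hM8
  have hM80 : 0 ≤ M8 := integral_nonneg fun y => by positivity
  refine ⟨Dstar * Dstar * M8, by positivity, fun n k hk r hr => ?_⟩
  haveI := pinnedChain_isProbabilityMeasure_gibbsMeasure hω hl.le hβ γ 1 hT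
  -- (iv) Markov under `μ_1`
  have h1 : (P.gibbsMeasure 1 T) {y : PhaseSpace 1 | r < |y.1 0|} ≤ ENNReal.ofReal (M8 / r ^ 8) := by
    have hsub : {y : PhaseSpace 1 | r < |y.1 0|} ⊆ {y : PhaseSpace 1 | r ^ 8 ≤ y.1 0 ^ 8} := by
      intro y hy
      have : r ^ 8 ≤ |y.1 0| ^ 8 := pow_le_pow_left₀ hr.le (le_of_lt hy) 8
      simpa [pow_abs, abs_of_nonneg (by positivity : (0:ℝ) ≤ y.1 0 ^ 8)] using this
    refine (measure_mono hsub).trans ?_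
    have hmk := mul_meas_ge_le_integral_of_nonneg (Eventually.of_forall fun y => by positivity) hi8 (r ^ 8)
    have hr8 : 0 < r ^ 8 := pow_pos hr 8
    have hreal : (P.gibbsMeasure 1 T).real {y : PhaseSpace 1 | r ^ 8 ≤ y.1 0 ^ 8} ≤ M8 / r ^ 8 := by
      rw [le_div_iff₀ hr8, mul_comm]; exact hmk
    calc (P.gibbsMeasure 1 T) {y : PhaseSpace 1 | r ^ 8 ≤ y.1 0 ^ 8}
        = ENNReal.ofReal ((P.gibbsMeasure 1 T).real {y : PhaseSpace 1 | r ^ 8 ≤ y.1 0 ^ 8}) :=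
          (ofReal_measureReal (measure_ne_top _ _)).symm
      _ ≤ ENNReal.ofReal (M8 / r ^ 8) := ENNReal.ofReal_le_ofReal hreal
  -- (iii) the first site of the `(k+1)`-chain is a window of size one
  obtain ⟨D₀, hD₀m, hD₀b, hmap₀⟩ := hwin k 0 (Nat.zero_le k)
  have h2 : (P.gibbsMeasure (k + 1) T) {y : PhaseSpace (k + 1) | r < |y.1 ⟨0, by omega⟩|} ≤
      ENNReal.ofReal Dstar * ENNReal.ofReal (M8 / r ^ 8) := by
    have hS : MeasurableSet {y : PhaseSpace 1 | r < |y.1 0|} :=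
      measurableSet_lt measurable_const ((measurable_pi_apply 0).comp measurable_fst).abs
    have e : {y : PhaseSpace (k + 1) | r < |y.1 ⟨0, by omega⟩|} =
        (fun y : PhaseSpace (k + 1) => ((Fin.take 1 (Nat.succ_le_succ (Nat.zero_le k)) y.1 : Fin 1 → ℝ),
          (Fin.take 1 (Nat.succ_le_succ (Nat.zero_le k)) y.2 : Fin 1 → ℝ))) ⁻¹' {y : PhaseSpace 1 | r < |y.1 0|} := by
      ext y; exact Iff.rfl
    rw [e, ← lintegral_indicator_one (measurable_take 1 (k + 1) (Nat.succ_le_succ (Nat.zero_le k)) hS)]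
    have h := lintegral_comp_take_le (Nat.zero_le k) hD₀m hD₀b hmap₀ (g := {y : PhaseSpace 1 | r < |y.1 0|}.indicator 1)
      (measurable_one.indicator hS)
    refine (le_of_eq ?_).trans (h.trans (mul_le_mul' le_rfl ?_))
    · rfl
    · rw [lintegral_indicator_one hS]; exact h1
  -- (ii) left–right symmetry: the last site of the `(k+1)`-chain has the law of the first
  have h3 : (P.gibbsMeasure (k + 1) T) {y : PhaseSpace (k + 1) | r < |y.1 (Fin.last k)|} =
      (P.gibbsMeasure (k + 1) T) {y : PhaseSpace (k + 1) | r < |y.1 ⟨0, by omega⟩|} := by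
    have hR := NonBallistic.measurePreserving_siteReflection_gibbsMeasure P (pinnedChain_V_neg ω₂ lam β γ) (k + 1) T
    have hS : MeasurableSet {y : PhaseSpace (k + 1) | r < |y.1 ⟨0, by omega⟩|} :=
      measurableSet_lt measurable_const ((measurable_pi_apply _).comp measurable_fst).abs
    have e : {y : PhaseSpace (k + 1) | r < |y.1 (Fin.last k)|} =
        siteReflection (k + 1) ⁻¹' {y : PhaseSpace (k + 1) | r < |y.1 ⟨0, by omega⟩|} := by
      ext y
      simp only [mem_setOf_eq, mem_preimage, siteReflection_fst]
      have : Fin.rev (⟨0, by omega⟩ : Fin (k + 1)) = Fin.last k := Fin.ext (by simp)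
      rw [this]
    rw [e, hR.measure_preimage hS.nullMeasurableSet]
  -- (i) the window `{0,…,k}` of the `(n+1)`-chain
  obtain ⟨D₁, hD₁m, hD₁b, hmap₁⟩ := hwin n k hk
  have hSk : MeasurableSet {y : PhaseSpace (k + 1) | r < |y.1 (Fin.last k)|} :=
    measurableSet_lt measurable_const ((measurable_pi_apply _).comp measurable_fst).abs
  have e : {x : PhaseSpace (n + 1) | r < |x.1 ⟨k, by omega⟩|} =
      (fun x : PhaseSpace (n + 1) => ((Fin.take (k + 1) (Nat.succ_le_succ hk) x.1 : Fin (k + 1) → ℝ),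
        (Fin.take (k + 1) (Nat.succ_le_succ hk) x.2 : Fin (k + 1) → ℝ))) ⁻¹' {y : PhaseSpace (k + 1) | r < |y.1 (Fin.last k)|} := by
    ext x; exact Iff.rfl
  rw [e, ← lintegral_indicator_one ((measurable_take (k + 1) (n + 1) (Nat.succ_le_succ hk)) hSk)]
  have h := lintegral_comp_take_le hk hD₁m hD₁b hmap₁ (g := {y : PhaseSpace (k + 1) | r < |y.1 (Fin.last k)|}.indicator 1)
    (measurable_one.indicator hSk)
  refine (le_of_eq rfl).trans (h.trans ?_)
  rw [lintegral_indicator_one hSk, h3]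
  refine (mul_le_mul' le_rfl h2).trans (le_of_eq ?_)
  rw [← ENNReal.ofReal_mul hD0.le, ← ENNReal.ofReal_mul hD0.le]
  congr 1
  field_simp

end Summit.AtomisticToContinuum.FouriersLaw.Theorems.HalfChainLocality

end
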